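import Literature.NumberTheory.LFunctions.ConreyIwaniec2002AFEKernelBounds
import Literature.NumberTheory.LFunctions.ConreyIwaniec2002AFEWeightDefs
import Literature.NumberTheory.LFunctions.WeightedMeanValueWindows
import HarnessLib

/-!
# Conrey–Iwaniec (2002), §8: the weights of (8.5)–(8.9) are admissible for §5

B. Conrey, H. Iwaniec, *Spacing of zeros of Hecke L-functions and the class number problem*,
Acta Arith. 103 (2002), §7 Lemma 7.2 (7.16)–(7.17), Lemma 7.4, (7.21)–(7.23); §8 (8.5)–(8.9)
[held text `paper:arxiv-math_0111012`, p0017–p0018].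

§8 estimates `Σ_s |B(s)|²` (`B = (A(s) − A(s′))/(s − s′)`) and `Σ_s |A(s) − N(s)|²` range by range
with the discrete mean-value theorems of §5 for sums `Σ_n a_n ω_s(log n) n^{−it}` whose weights
depend on the point `s`: Lemma 5.3 needs `ω_s ∈ 𝒞¹`, `‖ω_s‖₂² + ‖ω_s′‖₂² ≤ c` uniformly in `s`
(the tree's `WeightedMeanValue.weighted_discreteMeanValue(_integral)`, hypotheses packaged by
`window_weight_admissible` / `halfWindow_weight_admissible`). This file verifies those hypotheses
for the ACTUAL weights of §8, built from `V_s(e^u/Q)` (`afeVlog`) and the divided-difference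
weight `Ω_{t,t′}` (`afeOmega`) of `ConreyIwaniec2002AFEWeightDefs`, using only the bounds of
Lemma 7.2 / 7.4 landed as `ConreyIwaniec2002.afeV_bounds`:
* §1–§2: `u`-differentiability and the uniform bounds `‖V‖, ‖∂_uV‖ ≪ (1 + e^u/Q‖s‖)^{−6}`,
  `‖V − 1‖, ‖∂_uV‖ ≪ (e^u/Q‖s‖)^{1/4}`, `‖Ω‖ ≪ 1 + |u|`, `‖∂_uΩ‖ ≪ 2 + |u|` (`afeWeight_bounds`);
* §3: on a window `[0, β]` (ranges `n ≤ q⁴`, `n < 2T`): `c ≪ (β+3)³` for `Θ·Ω`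
  (`omega_window_admissible`), `c ≪ β + 2` for `Θ·V` (`afeVlog_window_admissible`),
  `c ≪ (e^{β+1}/Q‖s‖)^{1/2}(β+2)` for `Θ·(V − 1)` (`afeVlog_sub_one_window_admissible`);
* §4–§5: on the half-line `u ≥ log T − 1` (range `n > T`, where the coefficients carry the
  cut-off `a(n) = c₀η(n/T−1)(1+n/qT)^{−4}` of (6.38) and the weight carries `1/(c₀(1+n/qT)^4)`):
  the decay `(1 + y/‖s‖)^{−6}` of `V` beats `(1 + y/qT)^4` because `Q(2T+2) ≤ qT`, giving the
  logistic majorant `Φ(u) ≍ (log qT)/(1 + e^{u − L₁})`, `L₁ = log Q(2T+2)`, whence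
  `c ≪ c₀^{−2}(log qT)²(log q)` for `Θ₃·Ω·(1+e^u/qT)⁴/c₀` (`omega_tail_admissible`) and
  `c ≪ c₀^{−2} log q` for `Θ₃·V·(1+e^u/qT)⁴/c₀` (`afeVlog_tail_admissible`) — CI's
  "`c ≪ (log T)² log q`" of (8.7).
Everything PROVED; no definition.

«The programme SEARCHES and TYPES; no claim about Landau–Siegel zeros until a kernel theorem says so.»

## References
* [ConreyIwaniec2002] B. Conrey, H. Iwaniec, Acta Arith. 103 (2002) 259–312, arXiv:math/0111012:
  Lemma 7.2 (7.16)–(7.17), Lemma 7.4 (7.25), (7.21)–(7.23); §8 (8.5)–(8.9).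
-/

noncomputable section

open scoped NumberField
open Complex

namespace Literature.NumberTheory.LFunctions

namespace ConreyIwaniec2002

/-! ## §1. Calculus of `u ↦ V_w(e^u/Q)` -/

/-- `e^u/Q > 0`. [cite: ConreyIwaniec2002, §7 (7.6)] -/
theorem exp_div_condQ_pos {q : ℕ} (hq : 0 < q) (u : ℝ) : 0 < Real.exp u / condQ q :=
  div_pos (Real.exp_pos u) (condQ_pos hq)

/-- Chain rule: `d/du V_w(e^u/Q) = (e^u/Q)·∂_yV_w(e^u/Q)` — the `y∂_y` form of Lemma 7.2.
[cite: ConreyIwaniec2002, Lemma 7.2 (7.16)–(7.17), §8 (8.5)] -/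
theorem hasDerivAt_afeVlog {q : ℕ} {w : ℂ} {u : ℝ}
    (hd : DifferentiableAt ℝ (afeV w) (Real.exp u / condQ q)) :
    HasDerivAt (afeVlog q w)
      (((Real.exp u / condQ q : ℝ) : ℂ) * deriv (afeV w) (Real.exp u / condQ q)) u := by
  have h1 : HasDerivAt (fun u : ℝ => Real.exp u / condQ q) (Real.exp u / condQ q) u :=
    (Real.hasDerivAt_exp u).div_const _
  have h2 : HasDerivAt (afeV w) (deriv (afeV w) (Real.exp u / condQ q)) (Real.exp u / condQ q) :=
    hd.hasDerivAt
  have h := h2.scomp u h1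
  rw [Complex.real_smul] at h
  exact h

/-- `‖e^{(it − it′)u}‖ = 1`. [cite: ConreyIwaniec2002, §7 (7.21)] -/
theorem norm_exp_sub_mul_I_mul (t t' u : ℝ) :
    ‖Complex.exp (((t : ℂ) * I - t' * I) * u)‖ = 1 := by
  rw [show ((t : ℂ) * I - t' * I) * u = (((t - t') * u : ℝ) : ℂ) * I by push_cast; ring,
    Complex.norm_exp_ofReal_mul_I]

/-- `‖(1 − e^{(it−it′)u})/(it − it′)‖ ≤ |u|` (`|1 − e^{iθ}| ≤ |θ|`). [cite: ConreyIwaniec2002, §7 (7.21)] -/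
theorem norm_one_sub_exp_div_le {t t' : ℝ} (h : t ≠ t') (u : ℝ) :
    ‖(1 - Complex.exp (((t : ℂ) * I - t' * I) * u)) / ((t : ℂ) * I - t' * I)‖ ≤ |u| := by
  have hd : ((t : ℂ) * I - t' * I) = (((t - t') : ℝ) : ℂ) * I := by push_cast; ring
  have hne : t - t' ≠ 0 := sub_ne_zero.mpr h
  rw [hd, norm_div, norm_mul, Complex.norm_I, mul_one, Complex.norm_real, Real.norm_eq_abs,
    div_le_iff₀ (abs_pos.mpr hne), norm_sub_rev]
  have h1 := Real.norm_exp_I_mul_ofReal_sub_one_le (x := (t - t') * u)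
  rw [show I * (((t - t') * u : ℝ) : ℂ) = (((t - t') : ℝ) : ℂ) * I * (u : ℂ) by push_cast; ring] at h1
  refine h1.trans (le_of_eq ?_)
  rw [Real.norm_eq_abs, abs_mul, mul_comm]

/-- Derivative of `u ↦ (1 − e^{du})/d`: `−e^{du}` (`d = it − it′ ≠ 0`). [cite: ConreyIwaniec2002, §7 (7.21)] -/
theorem hasDerivAt_one_sub_exp_div {t t' : ℝ} (h : t ≠ t') (u : ℝ) :
    HasDerivAt (fun u : ℝ => (1 - Complex.exp (((t : ℂ) * I - t' * I) * u)) / ((t : ℂ) * I - t' * I))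
      (-Complex.exp (((t : ℂ) * I - t' * I) * u)) u := by
  set d : ℂ := (t : ℂ) * I - t' * I with hd
  have hne : d ≠ 0 := by
    rw [hd, ← sub_mul]
    refine mul_ne_zero ?_ I_ne_zero
    rw [sub_ne_zero]; exact fun h' => h (by exact_mod_cast h')
  have h1 : HasDerivAt (fun u : ℝ => d * (u : ℂ)) d u := by
    simpa using (Complex.ofRealCLM.hasDerivAt (x := u)).const_mul d
  have h2 : HasDerivAt (fun u : ℝ => Complex.exp (d * (u : ℂ))) (Complex.exp (d * u) * d) u :=
    (Complex.hasDerivAt_exp (d * u)).comp u h1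
  have h3 := ((hasDerivAt_const u (1 : ℂ)).sub h2).div_const d
  rw [zero_sub, neg_div, mul_div_cancel_right₀ _ hne] at h3
  exact h3

/-! ## §2. The uniform bounds (from Lemma 7.2 / 7.4, the tree's `afeV_bounds`) -/

/-- **Bounds for the weights** `V_w(e^u/Q)` and `Ω_{t,t′}(u)` and their `u`-derivatives, with ONE
absolute constant: for `3/8 ≤ Re w ≤ 5/8`, `|Im w| ≥ 1`:
`‖V_w‖, ‖∂_uV_w‖ ≤ C(1 + e^u/(Q‖w‖))^{−6}` and `‖V_w − 1‖, ‖∂_uV_w‖ ≤ C(e^u/(Q‖w‖))^{1/4}`;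
for `|t| ≥ 2`, `0 < |t − t′| ≤ 1` (`s = ½+it`, `s′ = ½+it′`):
`‖Ω‖ ≤ C(1 + e^u/(Q‖s‖))^{−6} + C(1 + e^u/(Q‖s′‖))^{−6}|u|` and
`‖∂_uΩ‖ ≤ C(1 + e^u/(Q‖s‖))^{−6} + C(1 + e^u/(Q‖s′‖))^{−6}(|u| + 1)`.
[cite: ConreyIwaniec2002, Lemma 7.2 (7.16)–(7.17), Lemma 7.4 (7.25), §8 (8.5)] -/
theorem afeWeight_bounds :
    ∃ C : ℝ, 0 < C ∧
      (∀ (q : ℕ), 0 < q → ∀ (w : ℂ) (u : ℝ), 3 / 8 ≤ w.re → w.re ≤ 5 / 8 → 1 ≤ |w.im| →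
        Differentiable ℝ (afeVlog q w) ∧
        ‖afeVlog q w u‖ ≤ C * ((1 + Real.exp u / condQ q / ‖w‖) ^ 6)⁻¹ ∧
        ‖deriv (afeVlog q w) u‖ ≤ C * ((1 + Real.exp u / condQ q / ‖w‖) ^ 6)⁻¹ ∧
        ‖afeVlog q w u - 1‖ ≤ C * (Real.exp u / condQ q / ‖w‖) ^ ((1 : ℝ) / 4) ∧
        ‖deriv (afeVlog q w) u‖ ≤ C * (Real.exp u / condQ q / ‖w‖) ^ ((1 : ℝ) / 4)) ∧
      (∀ (q : ℕ), 0 < q → ∀ (t t' u : ℝ), 2 ≤ |t| → t' ≠ t → |t' - t| ≤ 1 →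
        Differentiable ℝ (afeOmega q t t') ∧
        ‖afeOmega q t t' u‖ ≤
          C * ((1 + Real.exp u / condQ q / ‖(1 / 2 : ℂ) + t * I‖) ^ 6)⁻¹ +
            C * ((1 + Real.exp u / condQ q / ‖(1 / 2 : ℂ) + t' * I‖) ^ 6)⁻¹ * |u| ∧
        ‖deriv (afeOmega q t t') u‖ ≤
          C * ((1 + Real.exp u / condQ q / ‖(1 / 2 : ℂ) + t * I‖) ^ 6)⁻¹ +
            C * ((1 + Real.exp u / condQ q / ‖(1 / 2 : ℂ) + t' * I‖) ^ 6)⁻¹ * (|u| + 1)) := by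
  obtain ⟨C, hC, hA, hB⟩ := afeV_bounds
  refine ⟨C, hC, ?_, ?_⟩
  · intro q hq w u hre1 hre2 him
    have hy : ∀ u : ℝ, 0 < Real.exp u / condQ q := exp_div_condQ_pos hq
    have hdiff : Differentiable ℝ (afeVlog q w) := fun u =>
      (hasDerivAt_afeVlog (hA w _ hre1 hre2 him (hy u)).2.2.1).differentiableAt
    obtain ⟨h1, h2, h3, h4, h5⟩ := hA w _ hre1 hre2 him (hy u)
    have hder : deriv (afeVlog q w) u =
        ((Real.exp u / condQ q : ℝ) : ℂ) * deriv (afeV w) (Real.exp u / condQ q) :=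
      (hasDerivAt_afeVlog h3).deriv
    refine ⟨hdiff, h1, ?_, h2, ?_⟩
    · rw [hder]; exact h4
    · rw [hder]; exact h5
  · intro q hq t t' u ht htt' hdist
    have hy : ∀ u : ℝ, 0 < Real.exp u / condQ q := exp_div_condQ_pos hq
    set s : ℂ := 1 / 2 + t * I with hs
    set s' : ℂ := 1 / 2 + t' * I with hs'
    have hsre : s.re = 1 / 2 := by simp [hs]
    have hs're : s'.re = 1 / 2 := by simp [hs']
    have hsim : s.im = t := by simp [hs]
    have hs'im : s'.im = t' := by simp [hs']
    have ht1 : 1 ≤ |s.im| := by rw [hsim]; linarith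
    have ht'1 : 1 ≤ |s'.im| := by
      rw [hs'im]
      have := abs_sub_abs_le_abs_sub t' t
      have h2 : |t| - |t'| ≤ |t' - t| := by rw [abs_sub_comm]; exact abs_sub_abs_le_abs_sub t t'
      linarith
    have hAs : ∀ u, _ := fun u : ℝ => hA s _ (by rw [hsre]; norm_num) (by rw [hsre]; norm_num) ht1 (hy u)
    have hAs' : ∀ u, _ := fun u : ℝ => hA s' _ (by rw [hs're]; norm_num) (by rw [hs're]; norm_num) ht'1 (hy u)
    have hBu : ∀ u, _ := fun u : ℝ => hB t t' _ ht htt' hdist (hy u)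
    -- derivatives of the two `V`'s
    have hDs : ∀ u, HasDerivAt (afeVlog q s)
        (((Real.exp u / condQ q : ℝ) : ℂ) * deriv (afeV s) (Real.exp u / condQ q)) u :=
      fun u => hasDerivAt_afeVlog (hAs u).2.2.1
    have hDs' : ∀ u, HasDerivAt (afeVlog q s')
        (((Real.exp u / condQ q : ℝ) : ℂ) * deriv (afeV s') (Real.exp u / condQ q)) u :=
      fun u => hasDerivAt_afeVlog (hAs' u).2.2.1
    set d : ℂ := (t : ℂ) * I - t' * I with hd
    have htne : t ≠ t' := fun h => htt' h.symm
    have hne : d ≠ 0 := by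
      rw [hd, ← sub_mul]
      refine mul_ne_zero ?_ I_ne_zero
      rw [sub_ne_zero]; exact fun h' => htne (by exact_mod_cast h')
    -- the derivative of `Ω`
    have hDΩ : ∀ u, HasDerivAt (afeOmega q t t')
        ((((Real.exp u / condQ q : ℝ) : ℂ) * deriv (afeV s) (Real.exp u / condQ q) -
            ((Real.exp u / condQ q : ℝ) : ℂ) * deriv (afeV s') (Real.exp u / condQ q)) / d +
          (((Real.exp u / condQ q : ℝ) : ℂ) * deriv (afeV s') (Real.exp u / condQ q) *
              ((1 - Complex.exp (d * u)) / d) +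
            afeVlog q s' u * (-Complex.exp (d * u)))) u := by
      intro u
      have h1 := ((hDs u).sub (hDs' u)).div_const d
      have h2 := (hDs' u).mul (hasDerivAt_one_sub_exp_div htne u)
      exact h1.add h2
    have hdiffΩ : Differentiable ℝ (afeOmega q t t') := fun u => (hDΩ u).differentiableAt
    refine ⟨hdiffΩ, ?_, ?_⟩
    · -- ‖Ω‖
      obtain ⟨hV, -⟩ := hBu u
      obtain ⟨h1', -, -, -, -⟩ := hAs' u
      have hE := norm_one_sub_exp_div_le htne u
      change ‖(afeVlog q s u - afeVlog q s' u) / d + afeVlog q s' u * ((1 - Complex.exp (d * u)) / d)‖ ≤ _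
      calc ‖(afeVlog q s u - afeVlog q s' u) / d + afeVlog q s' u * ((1 - Complex.exp (d * u)) / d)‖
          ≤ ‖(afeVlog q s u - afeVlog q s' u) / d‖ + ‖afeVlog q s' u‖ * ‖(1 - Complex.exp (d * u)) / d‖ := by
            refine (norm_add_le _ _).trans ?_; rw [norm_mul]
        _ ≤ C * ((1 + Real.exp u / condQ q / ‖s‖) ^ 6)⁻¹ +
            C * ((1 + Real.exp u / condQ q / ‖s'‖) ^ 6)⁻¹ * |u| := by
            have hV1 : ‖afeVlog q s' u‖ ≤ C * ((1 + Real.exp u / condQ q / ‖s'‖) ^ 6)⁻¹ := h1'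
            have hV2 : ‖(afeVlog q s u - afeVlog q s' u) / d‖ ≤
                C * ((1 + Real.exp u / condQ q / ‖s‖) ^ 6)⁻¹ := hV
            have hE' : ‖(1 - Complex.exp (d * u)) / d‖ ≤ |u| := hE
            gcongr
    · -- ‖Ω′‖
      rw [(hDΩ u).deriv]
      obtain ⟨-, hV'⟩ := hBu u
      obtain ⟨h1', -, -, h4', -⟩ := hAs' u
      have hE := norm_one_sub_exp_div_le htne u
      have hE1 : ‖-Complex.exp (d * u)‖ = 1 := by rw [norm_neg, hd]; exact norm_exp_sub_mul_I_mul t t' u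
      have hy0 : (0 : ℝ) ≤ ((1 + Real.exp u / condQ q / ‖s'‖) ^ 6)⁻¹ := by positivity
      calc ‖(((Real.exp u / condQ q : ℝ) : ℂ) * deriv (afeV s) (Real.exp u / condQ q) -
              ((Real.exp u / condQ q : ℝ) : ℂ) * deriv (afeV s') (Real.exp u / condQ q)) / d +
            (((Real.exp u / condQ q : ℝ) : ℂ) * deriv (afeV s') (Real.exp u / condQ q) *
                ((1 - Complex.exp (d * u)) / d) +
              afeVlog q s' u * -Complex.exp (d * u))‖
          ≤ ‖(((Real.exp u / condQ q : ℝ) : ℂ) * deriv (afeV s) (Real.exp u / condQ q) -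
              ((Real.exp u / condQ q : ℝ) : ℂ) * deriv (afeV s') (Real.exp u / condQ q)) / d‖ +
            (‖((Real.exp u / condQ q : ℝ) : ℂ) * deriv (afeV s') (Real.exp u / condQ q)‖ *
                ‖(1 - Complex.exp (d * u)) / d‖ +
              ‖afeVlog q s' u‖ * ‖-Complex.exp (d * u)‖) := by
            refine (norm_add_le _ _).trans ?_
            gcongr
            refine (norm_add_le _ _).trans ?_
            exact add_le_add (norm_mul_le _ _) (norm_mul_le _ _)
        _ ≤ C * ((1 + Real.exp u / condQ q / ‖s‖) ^ 6)⁻¹ +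
            (C * ((1 + Real.exp u / condQ q / ‖s'‖) ^ 6)⁻¹ * |u| +
              C * ((1 + Real.exp u / condQ q / ‖s'‖) ^ 6)⁻¹ * 1) := by
            have hV1 : ‖afeVlog q s' u‖ ≤ C * ((1 + Real.exp u / condQ q / ‖s'‖) ^ 6)⁻¹ := h1'
            have hA1 : ‖(((Real.exp u / condQ q : ℝ) : ℂ) * deriv (afeV s) (Real.exp u / condQ q) -
                ((Real.exp u / condQ q : ℝ) : ℂ) * deriv (afeV s') (Real.exp u / condQ q)) / d‖ ≤
                C * ((1 + Real.exp u / condQ q / ‖s‖) ^ 6)⁻¹ := by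
              rw [← mul_sub]; exact hV'
            have hE' : ‖(1 - Complex.exp (d * u)) / d‖ ≤ |u| := hE
            rw [hE1]
            gcongr
        _ = C * ((1 + Real.exp u / condQ q / ‖s‖) ^ 6)⁻¹ +
            C * ((1 + Real.exp u / condQ q / ‖s'‖) ^ 6)⁻¹ * (|u| + 1) := by ring

/-! ## §3. Admissible weights for the short ranges (`n < 2T`): `ω_t = Θ·Ω_{t,t′}`, `Θ·V_s`, `Θ·(V_s − 1)` -/

/-- `((1 + x)^6)⁻¹ ≤ 1` for `x ≥ 0`. [cite: ConreyIwaniec2002, §8 (8.5)–(8.7)] -/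
theorem inv_one_add_pow_six_le_one {x : ℝ} (hx : 0 ≤ x) : ((1 + x) ^ 6)⁻¹ ≤ 1 :=
  inv_le_one_of_one_le₀ (one_le_pow₀ (by linarith))

/-- **The weight `Θ·Ω_{t,t′}` on a window `[0, β]` is admissible with
`‖ω‖₂² + ‖ω′‖₂² ≤ K(β + 3)³`** (`Θ` the smooth window of `exists_smoothWindow` for `[0, β]`,
`K` absolute): CI §8 (8.5)–(8.6), the ranges `n ≤ q⁴` (`β = 4 log q`, `c ≪ (log q)³`) and
`n < 2T` (`β = log 2T`, `c ≪ (log T)³`). [cite: ConreyIwaniec2002, §8 (8.5)–(8.6)] -/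
theorem omega_window_admissible :
    ∃ K : ℝ, 0 < K ∧ ∀ β : ℝ, 0 ≤ β → ∃ Θ : ℝ → ℝ, (∀ u ∈ Set.Icc 0 β, Θ u = 1) ∧
      (∀ u, 0 ≤ Θ u ∧ Θ u ≤ 1) ∧
      ∀ (q : ℕ), 0 < q → ∀ (t t' : ℝ), 2 ≤ |t| → t' ≠ t → |t' - t| ≤ 1 →
        Differentiable ℝ (fun u => (Θ u : ℂ) * afeOmega q t t' u) ∧
        MeasureTheory.Integrable (fun u => (Θ u : ℂ) * afeOmega q t t' u) ∧
        MeasureTheory.Integrable (deriv (fun u => (Θ u : ℂ) * afeOmega q t t' u)) ∧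
        MeasureTheory.MemLp (fun u => (Θ u : ℂ) * afeOmega q t t' u) 2 ∧
        MeasureTheory.MemLp (deriv (fun u => (Θ u : ℂ) * afeOmega q t t' u)) 2 ∧
        (∫ u : ℝ, ‖(Θ u : ℂ) * afeOmega q t t' u‖ ^ 2) +
            (∫ u : ℝ, ‖deriv (fun u => (Θ u : ℂ) * afeOmega q t t' u) u‖ ^ 2) ≤
          K * (β + 3) ^ 3 := by
  obtain ⟨C, hC, -, hΩ⟩ := afeWeight_bounds
  obtain ⟨C₀, hC₀, hwin⟩ := WeightedMeanValue.exists_smoothWindow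
  refine ⟨(1 + (C₀ + 1) ^ 2) * C ^ 2, by positivity, fun β hβ => ?_⟩
  obtain ⟨Θ, hΘd, hΘ1, hΘ0, hΘ01, hΘ', hΘ'0⟩ := hwin 0 β hβ
  refine ⟨Θ, hΘ1, hΘ01, fun q hq t t' ht htt' hdist => ?_⟩
  have hQ : 0 < condQ q := condQ_pos hq
  have hM : ∀ u ∈ Set.Icc (0 - 1) (β + 1), ‖afeOmega q t t' u‖ ≤ C * (β + 3) := by
    intro u hu
    obtain ⟨-, h1, -⟩ := hΩ q hq t t' u ht htt' hdist
    have hu' : |u| ≤ β + 1 := abs_le.mpr ⟨by linarith [hu.1], hu.2⟩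
    have r1 := inv_one_add_pow_six_le_one
      (show 0 ≤ Real.exp u / condQ q / ‖(1 / 2 : ℂ) + t * I‖ by positivity)
    have r2 := inv_one_add_pow_six_le_one
      (show 0 ≤ Real.exp u / condQ q / ‖(1 / 2 : ℂ) + t' * I‖ by positivity)
    refine h1.trans ?_
    calc C * ((1 + Real.exp u / condQ q / ‖(1 / 2 : ℂ) + t * I‖) ^ 6)⁻¹ +
          C * ((1 + Real.exp u / condQ q / ‖(1 / 2 : ℂ) + t' * I‖) ^ 6)⁻¹ * |u|
        ≤ C * 1 + C * 1 * (β + 1) := by gcongr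
      _ ≤ C * (β + 3) := by nlinarith
  have hM' : ∀ u ∈ Set.Icc (0 - 1) (β + 1), ‖deriv (afeOmega q t t') u‖ ≤ C * (β + 3) := by
    intro u hu
    obtain ⟨-, -, h2⟩ := hΩ q hq t t' u ht htt' hdist
    have hu' : |u| ≤ β + 1 := abs_le.mpr ⟨by linarith [hu.1], hu.2⟩
    have r1 := inv_one_add_pow_six_le_one
      (show 0 ≤ Real.exp u / condQ q / ‖(1 / 2 : ℂ) + t * I‖ by positivity)
    have r2 := inv_one_add_pow_six_le_one
      (show 0 ≤ Real.exp u / condQ q / ‖(1 / 2 : ℂ) + t' * I‖ by positivity)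
    refine h2.trans ?_
    calc C * ((1 + Real.exp u / condQ q / ‖(1 / 2 : ℂ) + t * I‖) ^ 6)⁻¹ +
          C * ((1 + Real.exp u / condQ q / ‖(1 / 2 : ℂ) + t' * I‖) ^ 6)⁻¹ * (|u| + 1)
        ≤ C * 1 + C * 1 * (β + 1 + 1) := by gcongr
      _ = C * (β + 3) := by ring
  obtain ⟨hdiff, -, -⟩ := hΩ q hq t t' 0 ht htt' hdist
  obtain ⟨h1, h2, h3, h4, h5, h6⟩ := WeightedMeanValue.window_weight_admissible hβ hΘd hΘ0 hΘ01
    hΘ' hΘ'0 hdiff hM hM'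
  refine ⟨h1, h2, h3, h4, h5, h6.trans ?_⟩
  have hb : (β + 3) ^ 2 * (β - 0 + 2) ≤ (β + 3) ^ 3 := by
    rw [pow_succ (β + 3) 2]
    exact mul_le_mul_of_nonneg_left (by linarith) (sq_nonneg _)
  calc (1 + (C₀ + 1) ^ 2) * (C * (β + 3)) ^ 2 * (β - 0 + 2)
      = (1 + (C₀ + 1) ^ 2) * C ^ 2 * ((β + 3) ^ 2 * (β - 0 + 2)) := by ring
    _ ≤ (1 + (C₀ + 1) ^ 2) * C ^ 2 * (β + 3) ^ 3 := by gcongr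

/-- **The weight `Θ·V_s` on a window `[0, β]` is admissible with `‖ω‖₂² + ‖ω′‖₂² ≤ K(β + 2)`**
(`3/8 ≤ Re s ≤ 5/8`, `|Im s| ≥ 1`; `Θ` the smooth window for `[0, β]`): CI §8 (8.9), the range
`q⁴ < n < 2T` of `A(s) − N(s)` (`c ≪ log T`). [cite: ConreyIwaniec2002, §8 (8.9)] -/
theorem afeVlog_window_admissible :
    ∃ K : ℝ, 0 < K ∧ ∀ β : ℝ, 0 ≤ β → ∃ Θ : ℝ → ℝ, (∀ u ∈ Set.Icc 0 β, Θ u = 1) ∧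
      (∀ u, 0 ≤ Θ u ∧ Θ u ≤ 1) ∧
      ∀ (q : ℕ), 0 < q → ∀ (w : ℂ), 3 / 8 ≤ w.re → w.re ≤ 5 / 8 → 1 ≤ |w.im| →
        Differentiable ℝ (fun u => (Θ u : ℂ) * afeVlog q w u) ∧
        MeasureTheory.Integrable (fun u => (Θ u : ℂ) * afeVlog q w u) ∧
        MeasureTheory.Integrable (deriv (fun u => (Θ u : ℂ) * afeVlog q w u)) ∧
        MeasureTheory.MemLp (fun u => (Θ u : ℂ) * afeVlog q w u) 2 ∧
        MeasureTheory.MemLp (deriv (fun u => (Θ u : ℂ) * afeVlog q w u)) 2 ∧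
        (∫ u : ℝ, ‖(Θ u : ℂ) * afeVlog q w u‖ ^ 2) +
            (∫ u : ℝ, ‖deriv (fun u => (Θ u : ℂ) * afeVlog q w u) u‖ ^ 2) ≤
          K * (β + 2) := by
  obtain ⟨C, hC, hV, -⟩ := afeWeight_bounds
  obtain ⟨C₀, hC₀, hwin⟩ := WeightedMeanValue.exists_smoothWindow
  refine ⟨(1 + (C₀ + 1) ^ 2) * C ^ 2, by positivity, fun β hβ => ?_⟩
  obtain ⟨Θ, hΘd, hΘ1, hΘ0, hΘ01, hΘ', hΘ'0⟩ := hwin 0 β hβ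
  refine ⟨Θ, hΘ1, hΘ01, fun q hq w hre1 hre2 him => ?_⟩
  have hQ : 0 < condQ q := condQ_pos hq
  have hM : ∀ u ∈ Set.Icc (0 - 1) (β + 1), ‖afeVlog q w u‖ ≤ C := by
    intro u _
    obtain ⟨-, h1, -⟩ := hV q hq w u hre1 hre2 him
    have r1 := inv_one_add_pow_six_le_one (show 0 ≤ Real.exp u / condQ q / ‖w‖ by positivity)
    exact h1.trans (by nlinarith)
  have hM' : ∀ u ∈ Set.Icc (0 - 1) (β + 1), ‖deriv (afeVlog q w) u‖ ≤ C := by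
    intro u _
    obtain ⟨-, -, h2, -⟩ := hV q hq w u hre1 hre2 him
    have r1 := inv_one_add_pow_six_le_one (show 0 ≤ Real.exp u / condQ q / ‖w‖ by positivity)
    exact h2.trans (by nlinarith)
  obtain ⟨hdiff, -⟩ := hV q hq w 0 hre1 hre2 him
  obtain ⟨h1, h2, h3, h4, h5, h6⟩ := WeightedMeanValue.window_weight_admissible hβ hΘd hΘ0 hΘ01
    hΘ' hΘ'0 hdiff hM hM'
  refine ⟨h1, h2, h3, h4, h5, h6.trans (le_of_eq ?_)⟩
  ring

/-- **The weight `Θ·(V_s − 1)` on a window `[0, β]` is admissible with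
`‖ω‖₂² + ‖ω′‖₂² ≤ K (e^{β+1}/(Q‖s‖))^{1/2} (β + 2)`** (`3/8 ≤ Re s ≤ 5/8`, `|Im s| ≥ 1`): CI §8
(8.8)–(8.9), the range `n ≤ q⁴` of `A(s) − N(s)` where `V_s(n/Q) = 1 + O((n/QT)^{1/4})`.
[cite: ConreyIwaniec2002, §8 (8.8)–(8.9), Lemma 7.2 (7.17)] -/
theorem afeVlog_sub_one_window_admissible :
    ∃ K : ℝ, 0 < K ∧ ∀ β : ℝ, 0 ≤ β → ∃ Θ : ℝ → ℝ, (∀ u ∈ Set.Icc 0 β, Θ u = 1) ∧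
      (∀ u, 0 ≤ Θ u ∧ Θ u ≤ 1) ∧
      ∀ (q : ℕ), 0 < q → ∀ (w : ℂ), 3 / 8 ≤ w.re → w.re ≤ 5 / 8 → 1 ≤ |w.im| →
        Differentiable ℝ (fun u => (Θ u : ℂ) * (afeVlog q w u - 1)) ∧
        MeasureTheory.Integrable (fun u => (Θ u : ℂ) * (afeVlog q w u - 1)) ∧
        MeasureTheory.Integrable (deriv (fun u => (Θ u : ℂ) * (afeVlog q w u - 1))) ∧
        MeasureTheory.MemLp (fun u => (Θ u : ℂ) * (afeVlog q w u - 1)) 2 ∧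
        MeasureTheory.MemLp (deriv (fun u => (Θ u : ℂ) * (afeVlog q w u - 1))) 2 ∧
        (∫ u : ℝ, ‖(Θ u : ℂ) * (afeVlog q w u - 1)‖ ^ 2) +
            (∫ u : ℝ, ‖deriv (fun u => (Θ u : ℂ) * (afeVlog q w u - 1)) u‖ ^ 2) ≤
          K * (Real.exp (β + 1) / condQ q / ‖w‖) ^ ((1 : ℝ) / 2) * (β + 2) := by
  obtain ⟨C, hC, hV, -⟩ := afeWeight_bounds
  obtain ⟨C₀, hC₀, hwin⟩ := WeightedMeanValue.exists_smoothWindow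
  refine ⟨(1 + (C₀ + 1) ^ 2) * C ^ 2, by positivity, fun β hβ => ?_⟩
  obtain ⟨Θ, hΘd, hΘ1, hΘ0, hΘ01, hΘ', hΘ'0⟩ := hwin 0 β hβ
  refine ⟨Θ, hΘ1, hΘ01, fun q hq w hre1 hre2 him => ?_⟩
  have hQ : 0 < condQ q := condQ_pos hq
  have hw : 0 < ‖w‖ := by
    have : w ≠ 0 := fun h => by rw [h] at him; simp at him; linarith
    exact norm_pos_iff.mpr this
  set M : ℝ := C * (Real.exp (β + 1) / condQ q / ‖w‖) ^ ((1 : ℝ) / 4) with hMdef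
  have hM : ∀ u ∈ Set.Icc (0 - 1) (β + 1), ‖afeVlog q w u - 1‖ ≤ M := by
    intro u hu
    obtain ⟨-, -, -, h3, -⟩ := hV q hq w u hre1 hre2 him
    exact h3.trans (by rw [hMdef]; gcongr; exact hu.2)
  have hM' : ∀ u ∈ Set.Icc (0 - 1) (β + 1), ‖deriv (fun u => afeVlog q w u - 1) u‖ ≤ M := by
    intro u hu
    obtain ⟨hdiff, -, -, -, h4⟩ := hV q hq w u hre1 hre2 him
    rw [deriv_sub_const]
    exact h4.trans (by rw [hMdef]; gcongr; exact hu.2)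
  obtain ⟨hdiff, -⟩ := hV q hq w 0 hre1 hre2 him
  have hdiff' : Differentiable ℝ (fun u => afeVlog q w u - 1) := hdiff.sub_const 1
  obtain ⟨h1, h2, h3, h4, h5, h6⟩ := WeightedMeanValue.window_weight_admissible hβ hΘd hΘ0 hΘ01
    hΘ' hΘ'0 hdiff' hM hM'
  refine ⟨h1, h2, h3, h4, h5, h6.trans (le_of_eq ?_)⟩
  have hx0 : 0 ≤ Real.exp (β + 1) / condQ q / ‖w‖ := by positivity
  have hM2 : M ^ 2 = C ^ 2 * (Real.exp (β + 1) / condQ q / ‖w‖) ^ ((1 : ℝ) / 2) := by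
    rw [hMdef, mul_pow, ← Real.rpow_natCast ((Real.exp (β + 1) / condQ q / ‖w‖) ^ ((1 : ℝ) / 4)) 2,
      ← Real.rpow_mul hx0]
    norm_num
  rw [hM2]
  ring

/-! ## §4. The logistic majorant and its integral -/

/-- `∫_a^∞ du/(1 + e^{u−L}) = log(1 + e^{L−a})` (antiderivative `−log(1 + e^{L−u})`), with the
integrability. [cite: ConreyIwaniec2002, §8 (8.5)–(8.7)] -/
theorem integral_Ioi_inv_one_add_exp (a L : ℝ) :
    MeasureTheory.IntegrableOn (fun u : ℝ => (1 + Real.exp (u - L))⁻¹) (Set.Ioi a) ∧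
    ∫ u in Set.Ioi a, (1 + Real.exp (u - L))⁻¹ = Real.log (1 + Real.exp (L - a)) := by
  set F : ℝ → ℝ := fun u => -Real.log (1 + Real.exp (L - u)) with hF
  have hpos : ∀ u, 0 < 1 + Real.exp (L - u) := fun u => by positivity
  have hderiv : ∀ u, HasDerivAt F ((1 + Real.exp (u - L))⁻¹) u := by
    intro u
    have h1 : HasDerivAt (fun u : ℝ => L - u) (-1) u := (hasDerivAt_id u).const_sub L
    have h2 : HasDerivAt (fun u : ℝ => Real.exp (L - u)) (Real.exp (L - u) * (-1)) u :=
      (Real.hasDerivAt_exp (L - u)).comp u h1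
    have h3 : HasDerivAt (fun u : ℝ => 1 + Real.exp (L - u)) (Real.exp (L - u) * (-1)) u := by
      simpa using h2.const_add 1
    have h4 := (h3.log (hpos u).ne').neg
    refine h4.congr_deriv ?_
    have he : Real.exp (u - L) * Real.exp (L - u) = 1 := by
      rw [← Real.exp_add]; simp
    have hD : 0 < 1 + Real.exp (u - L) := by positivity
    rw [mul_neg_one, neg_div, neg_neg, inv_eq_one_div, div_eq_div_iff (hpos u).ne' hD.ne', one_mul,
      mul_add, mul_one, mul_comm (Real.exp (L - u)) (Real.exp (u - L)), he]
    ring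
  have hcont : Continuous F := by
    rw [hF]; fun_prop (disch := intro u; exact (hpos u).ne')
  have hlim : Filter.Tendsto F Filter.atTop (nhds 0) := by
    have h1 : Filter.Tendsto (fun u : ℝ => L - u) Filter.atTop Filter.atBot := by
      have := Filter.tendsto_atBot_add_const_left Filter.atTop L Filter.tendsto_neg_atTop_atBot
      simpa [sub_eq_add_neg] using this
    have h2 : Filter.Tendsto (fun u : ℝ => Real.exp (L - u)) Filter.atTop (nhds 0) :=
      Real.tendsto_exp_atBot.comp h1
    have h3 : Filter.Tendsto (fun u : ℝ => 1 + Real.exp (L - u)) Filter.atTop (nhds 1) := by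
      simpa using h2.const_add 1
    have h4 : Filter.Tendsto (fun u : ℝ => Real.log (1 + Real.exp (L - u))) Filter.atTop (nhds 0) := by
      simpa [Function.comp_def, Real.log_one] using
        (Real.continuousAt_log one_ne_zero).tendsto.comp h3
    simpa [hF] using h4.neg
  have hnn : ∀ u ∈ Set.Ioi a, 0 ≤ (1 + Real.exp (u - L))⁻¹ := fun u _ => by positivity
  have hint : MeasureTheory.IntegrableOn (fun u : ℝ => (1 + Real.exp (u - L))⁻¹) (Set.Ioi a) :=
    MeasureTheory.integrableOn_Ioi_deriv_of_nonneg hcont.continuousWithinAt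
      (fun u _ => hderiv u) hnn hlim
  refine ⟨hint, ?_⟩
  rw [MeasureTheory.integral_Ioi_of_hasDerivAt_of_tendsto hcont.continuousWithinAt
    (fun u _ => hderiv u) hint hlim, hF]
  simp

/-- `log(1 + e^x) ≤ 1 + x` for `x ≥ 0`. [cite: ConreyIwaniec2002, §8 (8.5)–(8.7)] -/
theorem log_one_add_exp_le {x : ℝ} (hx : 0 ≤ x) : Real.log (1 + Real.exp x) ≤ 1 + x := by
  have h1 : 1 + Real.exp x ≤ Real.exp (1 + x) := by
    rw [Real.exp_add]
    have := Real.add_one_le_exp (1 : ℝ)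
    have hx' : 1 ≤ Real.exp x := Real.one_le_exp hx
    nlinarith
  calc Real.log (1 + Real.exp x) ≤ Real.log (Real.exp (1 + x)) :=
        Real.log_le_log (by positivity) h1
    _ = 1 + x := Real.log_exp _

/-- The two-case inequality behind the logistic majorant: for `L ≥ 0` and all real `u`,
`(5u + 6)·(1 + e^{u−L})^{−2} ≤ (5L + 6)·(1 + e^{u−L})^{−1}`. [cite: ConreyIwaniec2002, §8 (8.5)–(8.7)] -/
theorem lin_mul_inv_sq_le {u L : ℝ} (hL : 0 ≤ L) :
    (5 * u + 6) * ((1 + Real.exp (u - L)) ^ 2)⁻¹ ≤ (5 * L + 6) * (1 + Real.exp (u - L))⁻¹ := by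
  have hE : 0 < Real.exp (u - L) := Real.exp_pos _
  have hD : 0 < 1 + Real.exp (u - L) := by linarith
  rw [← div_eq_mul_inv, ← div_eq_mul_inv, div_le_div_iff₀ (pow_pos hD 2) hD]
  suffices h : 5 * u + 6 ≤ (5 * L + 6) * (1 + Real.exp (u - L)) by
    have h2 : 0 ≤ (5 * L + 6) * (1 + Real.exp (u - L)) := by positivity
    nlinarith [h, h2, hD]
  rcases le_or_gt u L with h | h
  · nlinarith [hE]
  · have hx : 1 + (u - L) ≤ Real.exp (u - L) := by
      have := Real.add_one_le_exp (u - L); linarith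
    nlinarith [hx, hE, mul_nonneg (by linarith : 0 ≤ 5 * L + 1) (by linarith : 0 ≤ u - L),
      mul_le_mul_of_nonneg_left hx (by linarith : 0 ≤ 5 * L + 6)]

/-! ## §5. Admissible weights for the long range (`n > T`): `Θ·Ω·(1 + e^u/qT)⁴/c₀`, `Θ·V·(1 + e^u/qT)⁴/c₀` -/

/-- `((1 + y/‖w‖)^6)⁻¹ ≤ ((1 + y/T₁)^6)⁻¹` for `0 < ‖w‖ ≤ T₁`, `y ≥ 0`. [cite: ConreyIwaniec2002, §8 (8.5)–(8.7)] -/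
theorem inv_pow_six_anti {y nw T₁ : ℝ} (hy : 0 ≤ y) (hw : 0 < nw) (hwT : nw ≤ T₁) :
    ((1 + y / nw) ^ 6)⁻¹ ≤ ((1 + y / T₁) ^ 6)⁻¹ := by
  have hT : 0 < T₁ := lt_of_lt_of_le hw hwT
  have h1 : y / T₁ ≤ y / nw := div_le_div_of_nonneg_left hy hw hwT
  have h2 : 0 < 1 + y / T₁ := by positivity
  exact inv_anti₀ (pow_pos h2 6) (pow_le_pow_left₀ h2.le (by linarith) 6)

/-- `(1+x)^{−6}·p ≤ (1+x)^{−2}` when `p ≤ (1+x)^4`, `x ≥ 0`. [cite: ConreyIwaniec2002, §8 (8.5)–(8.7)] -/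
theorem inv_pow_six_mul_le {x p : ℝ} (hx : 0 ≤ x) (hp4 : p ≤ (1 + x) ^ 4) :
    ((1 + x) ^ 6)⁻¹ * p ≤ ((1 + x) ^ 2)⁻¹ := by
  have h1 : 0 < 1 + x := by linarith
  rw [inv_mul_le_iff₀ (pow_pos h1 6), show (1 + x) ^ 6 = (1 + x) ^ 4 * (1 + x) ^ 2 by ring,
    mul_assoc, mul_inv_cancel₀ (pow_pos h1 2).ne', mul_one]
  exact hp4

/-- `log(1 + e^x) ≤ 1 + max(x, 0)`. [cite: ConreyIwaniec2002, §8 (8.5)–(8.7)] -/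
theorem log_one_add_exp_le_max (x : ℝ) : Real.log (1 + Real.exp x) ≤ 1 + max x 0 := by
  have h1 : Real.exp x ≤ Real.exp (max x 0) := Real.exp_le_exp.mpr (le_max_left _ _)
  calc Real.log (1 + Real.exp x) ≤ Real.log (1 + Real.exp (max x 0)) :=
        Real.log_le_log (by positivity) (by linarith)
    _ ≤ 1 + max x 0 := log_one_add_exp_le (le_max_right _ _)

/-- **The logistic majorant is square-integrable on a half-line with the explicit bound**
`∫_{[a,∞)} (M/(1+e^{u−L}))² ≤ M²(1 + max(L − a, 0))`, together with the integrability
of `Φ` and `Φ²` on `[a, ∞)`. [cite: ConreyIwaniec2002, §8 (8.5)–(8.7)] -/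
theorem logistic_majorant_integral (a L M : ℝ) :
    MeasureTheory.IntegrableOn (fun u : ℝ => M * (1 + Real.exp (u - L))⁻¹) (Set.Ici a) ∧
    MeasureTheory.IntegrableOn (fun u : ℝ => (M * (1 + Real.exp (u - L))⁻¹) ^ 2) (Set.Ici a) ∧
    ∫ u in Set.Ici a, (M * (1 + Real.exp (u - L))⁻¹) ^ 2 ≤ M ^ 2 * (1 + max (L - a) 0) := by
  obtain ⟨hint, hval⟩ := integral_Ioi_inv_one_add_exp a L
  have hint' : MeasureTheory.IntegrableOn (fun u : ℝ => (1 + Real.exp (u - L))⁻¹) (Set.Ici a) :=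
    (integrableOn_Ici_iff_integrableOn_Ioi (f := fun u : ℝ => (1 + Real.exp (u - L))⁻¹)).mpr hint
  have h1 : MeasureTheory.IntegrableOn (fun u : ℝ => M * (1 + Real.exp (u - L))⁻¹) (Set.Ici a) :=
    hint'.const_mul M
  have hle1 : ∀ u : ℝ, (1 + Real.exp (u - L))⁻¹ ≤ 1 := fun u =>
    inv_le_one_of_one_le₀ (by linarith [Real.exp_pos (u - L)])
  have hnn : ∀ u : ℝ, 0 ≤ (1 + Real.exp (u - L))⁻¹ := fun u => by positivity
  have hptw : ∀ u : ℝ, (M * (1 + Real.exp (u - L))⁻¹) ^ 2 ≤ M ^ 2 * (1 + Real.exp (u - L))⁻¹ := by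
    intro u
    rw [mul_pow, sq ((1 + Real.exp (u - L))⁻¹)]
    calc M ^ 2 * ((1 + Real.exp (u - L))⁻¹ * (1 + Real.exp (u - L))⁻¹)
        ≤ M ^ 2 * ((1 + Real.exp (u - L))⁻¹ * 1) := by gcongr; exact hle1 u
      _ = M ^ 2 * (1 + Real.exp (u - L))⁻¹ := by rw [mul_one]
  have hcont : Continuous fun u : ℝ => (M * (1 + Real.exp (u - L))⁻¹) ^ 2 := by
    fun_prop (disch := intro u; positivity)
  have h2 : MeasureTheory.IntegrableOn (fun u : ℝ => (M * (1 + Real.exp (u - L))⁻¹) ^ 2) (Set.Ici a) := by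
    refine MeasureTheory.Integrable.mono' (hint'.const_mul (M ^ 2)) hcont.aestronglyMeasurable ?_
    refine MeasureTheory.ae_of_all _ fun u => ?_
    rw [Real.norm_eq_abs, abs_of_nonneg (by positivity)]
    exact hptw u
  refine ⟨h1, h2, ?_⟩
  calc ∫ u in Set.Ici a, (M * (1 + Real.exp (u - L))⁻¹) ^ 2
      ≤ ∫ u in Set.Ici a, M ^ 2 * (1 + Real.exp (u - L))⁻¹ :=
        MeasureTheory.setIntegral_mono_on h2 (hint'.const_mul (M ^ 2)) measurableSet_Ici
          (fun u _ => hptw u)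
    _ = M ^ 2 * Real.log (1 + Real.exp (L - a)) := by
        rw [MeasureTheory.integral_const_mul, MeasureTheory.integral_Ici_eq_integral_Ioi, hval]
    _ ≤ M ^ 2 * (1 + max (L - a) 0) := by gcongr; exact log_one_add_exp_le_max _

/-- Derivative of `u ↦ (1 + e^u/Y)^4 / c₀`. [cite: ConreyIwaniec2002, §8 (8.7)] -/
theorem hasDerivAt_tailP (Y c₀ u : ℝ) :
    HasDerivAt (fun u : ℝ => (1 + Real.exp u / Y) ^ 4 / c₀)
      (4 * (1 + Real.exp u / Y) ^ 3 * (Real.exp u / Y) / c₀) u := by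
  have h1 : HasDerivAt (fun u : ℝ => 1 + Real.exp u / Y) (Real.exp u / Y) u := by
    simpa using ((Real.hasDerivAt_exp u).div_const Y).const_add 1
  have h2 := (h1.pow 4).div_const c₀
  refine h2.congr_deriv ?_
  push_cast
  ring

/-- **Pointwise majorant for the long-range weight `Ω̃ = Ω_{t,t′}·(1 + e^u/qT)⁴/c₀`**: on
`u ≥ log T − 1` (`T ≥ 3`, `Q(2T+2) ≤ qT`, `‖s‖, ‖s′‖ ≤ 2T + 2`), with `L₁ = log(Q(2T+2))`,
`‖Ω̃(u)‖, ‖Ω̃′(u)‖ ≤ (C/c₀)(5L₁ + 6)/(1 + e^{u−L₁})` (the decay `(1 + y/‖s‖)^{−6}` of `V` beats the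
growth `(1 + y/qT)^4` of `1/a`). [cite: ConreyIwaniec2002, §8 (8.5)–(8.7), Lemma 7.2 (7.16)] -/
theorem omega_tail_pointwise :
    ∃ C : ℝ, 0 < C ∧ ∀ (q : ℕ), 0 < q → ∀ (T c₀ : ℝ), 3 ≤ T → 0 < c₀ →
      condQ q * (2 * T + 2) ≤ q * T →
      ∀ (t t' : ℝ), 2 ≤ |t| → t' ≠ t → |t' - t| ≤ 1 →
        ‖(1 / 2 : ℂ) + t * I‖ ≤ 2 * T + 2 → ‖(1 / 2 : ℂ) + t' * I‖ ≤ 2 * T + 2 →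
        Differentiable ℝ (fun u : ℝ =>
          afeOmega q t t' u * (((1 + Real.exp u / (q * T)) ^ 4 / c₀ : ℝ) : ℂ)) ∧
        ∀ u : ℝ, Real.log T - 1 ≤ u →
          ‖afeOmega q t t' u * (((1 + Real.exp u / (q * T)) ^ 4 / c₀ : ℝ) : ℂ)‖ ≤
            C / c₀ * (5 * Real.log (condQ q * (2 * T + 2)) + 6) *
              (1 + Real.exp (u - Real.log (condQ q * (2 * T + 2))))⁻¹ ∧
          ‖deriv (fun u : ℝ =>
              afeOmega q t t' u * (((1 + Real.exp u / (q * T)) ^ 4 / c₀ : ℝ) : ℂ)) u‖ ≤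
            C / c₀ * (5 * Real.log (condQ q * (2 * T + 2)) + 6) *
              (1 + Real.exp (u - Real.log (condQ q * (2 * T + 2))))⁻¹ := by
  obtain ⟨C, hC, -, hΩ⟩ := afeWeight_bounds
  refine ⟨C, hC, ?_⟩
  intro q hq T c₀ hT hc₀ hQT t t' ht htt' hdist hs hs'
  have hQ : 0 < condQ q := condQ_pos hq
  have hq0 : (0 : ℝ) < q := by exact_mod_cast hq
  have hT0 : 0 < T := by linarith
  set T₁ : ℝ := 2 * T + 2 with hT₁
  have hT₁0 : 0 < T₁ := by rw [hT₁]; linarith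
  set L₁ : ℝ := Real.log (condQ q * T₁) with hL₁
  have hQT₁ : 0 < condQ q * T₁ := mul_pos hQ hT₁0
  -- `log T − 1 ≥ 0` and `L₁ ≥ 0`
  have hlogT : 1 ≤ Real.log T := by
    rw [Real.le_log_iff_exp_le hT0]
    exact le_trans Real.exp_one_lt_d9.le (by linarith)
  have hL₁0 : 0 ≤ L₁ := by
    rw [hL₁]
    apply Real.log_nonneg
    -- `Q T₁ ≥ Q·8 ≥ 1`: `Q = √q/2π ≥ 1/(2π)`... use `Q T₁ ≥ T/e`? simpler: `qT ≥ Q T₁` is an upper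
    -- bound; for the lower bound use `condQ q ≥ 1/(2π)·1` and `T₁ ≥ 8`.
    have hQ1 : 1 / (2 * Real.pi) ≤ condQ q := by
      unfold condQ
      gcongr
      have : (1 : ℝ) ≤ q := by exact_mod_cast hq
      exact le_trans (by norm_num) (Real.one_le_sqrt.mpr this)
    have hpi : Real.pi ≤ 4 := Real.pi_le_four
    have h8 : 8 ≤ T₁ := by rw [hT₁]; linarith
    calc (1 : ℝ) = 1 / (2 * 4) * 8 := by norm_num
      _ ≤ 1 / (2 * Real.pi) * T₁ := by gcongr
      _ ≤ condQ q * T₁ := by gcongr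
  -- the functions
  set P : ℝ → ℝ := fun u => (1 + Real.exp u / (q * T)) ^ 4 / c₀ with hP
  set P' : ℝ → ℝ := fun u => 4 * (1 + Real.exp u / (q * T)) ^ 3 * (Real.exp u / (q * T)) / c₀
    with hP'
  have hPd : ∀ u, HasDerivAt P (P' u) u := fun u => hasDerivAt_tailP (q * T) c₀ u
  have hΩd : Differentiable ℝ (afeOmega q t t') := (hΩ q hq t t' 0 ht htt' hdist).1
  have hprod : ∀ u, HasDerivAt (fun u : ℝ => afeOmega q t t' u * ((P u : ℝ) : ℂ))
      (deriv (afeOmega q t t') u * ((P u : ℝ) : ℂ) + afeOmega q t t' u * ((P' u : ℝ) : ℂ)) u :=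
    fun u => (hΩd u).hasDerivAt.mul (hPd u).ofReal_comp
  refine ⟨fun u => (hprod u).differentiableAt, fun u hu => ?_⟩
  have hu0 : 0 ≤ u := by linarith
  have habs : |u| = u := abs_of_nonneg hu0
  obtain ⟨-, hΩ0, hΩ1⟩ := hΩ q hq t t' u ht htt' hdist
  -- the key comparisons
  set x : ℝ := Real.exp u / (condQ q * T₁) with hx
  have hx0 : 0 ≤ x := by positivity
  have hxexp : Real.exp (u - L₁) = x := by
    rw [hx, Real.exp_sub, hL₁, Real.exp_log hQT₁]
  have hs0 : 0 < ‖(1 / 2 : ℂ) + t * I‖ := by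
    refine norm_pos_iff.mpr fun h => ?_
    have := congrArg Complex.re h; simp at this
  have hs'0 : 0 < ‖(1 / 2 : ℂ) + t' * I‖ := by
    refine norm_pos_iff.mpr fun h => ?_
    have := congrArg Complex.re h; simp at this
  have hy0 : 0 ≤ Real.exp u / condQ q := by positivity
  have hr : ((1 + Real.exp u / condQ q / ‖(1 / 2 : ℂ) + t * I‖) ^ 6)⁻¹ ≤ ((1 + x) ^ 6)⁻¹ := by
    have h := inv_pow_six_anti hy0 hs0 hs
    rwa [hx, ← div_div]
  have hr' : ((1 + Real.exp u / condQ q / ‖(1 / 2 : ℂ) + t' * I‖) ^ 6)⁻¹ ≤ ((1 + x) ^ 6)⁻¹ := by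
    have h := inv_pow_six_anti hy0 hs'0 hs'
    rwa [hx, ← div_div]
  have hqT0 : 0 < (q : ℝ) * T := mul_pos hq0 hT0
  have hexqT : Real.exp u / (q * T) ≤ x := by
    rw [hx]; exact div_le_div_of_nonneg_left (Real.exp_pos u).le hQT₁ hQT
  have hP0 : 0 ≤ (1 + Real.exp u / (q * T)) ^ 4 := by positivity
  have hP4 : (1 + Real.exp u / (q * T)) ^ 4 ≤ (1 + x) ^ 4 := by
    have : 0 ≤ Real.exp u / (q * T) := by positivity
    gcongr
  have hPn : ‖((P u : ℝ) : ℂ)‖ = (1 + Real.exp u / (q * T)) ^ 4 / c₀ := by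
    rw [Complex.norm_real, Real.norm_eq_abs, hP, abs_of_nonneg (by positivity)]
  have hP'le : ‖((P' u : ℝ) : ℂ)‖ ≤ 4 * ((1 + Real.exp u / (q * T)) ^ 4 / c₀) := by
    rw [Complex.norm_real, Real.norm_eq_abs, hP', abs_of_nonneg (by positivity)]
    have h1 : Real.exp u / (q * T) ≤ 1 + Real.exp u / (q * T) := by linarith
    have h3 : 0 ≤ (1 + Real.exp u / (q * T)) ^ 3 := by positivity
    calc 4 * (1 + Real.exp u / (q * T)) ^ 3 * (Real.exp u / (q * T)) / c₀
        ≤ 4 * (1 + Real.exp u / (q * T)) ^ 3 * (1 + Real.exp u / (q * T)) / c₀ := by gcongr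
      _ = 4 * ((1 + Real.exp u / (q * T)) ^ 4 / c₀) := by ring
  -- `‖Ω‖ ≤ C(1+u)(1+x)^{-6}`, `‖Ω′‖ ≤ C(u+2)(1+x)^{-6}`
  have hΩ0' : ‖afeOmega q t t' u‖ ≤ C * (1 + u) * ((1 + x) ^ 6)⁻¹ := by
    refine hΩ0.trans ?_
    rw [habs]
    calc C * ((1 + Real.exp u / condQ q / ‖(1 / 2 : ℂ) + t * I‖) ^ 6)⁻¹ +
          C * ((1 + Real.exp u / condQ q / ‖(1 / 2 : ℂ) + t' * I‖) ^ 6)⁻¹ * u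
        ≤ C * ((1 + x) ^ 6)⁻¹ + C * ((1 + x) ^ 6)⁻¹ * u := by gcongr
      _ = C * (1 + u) * ((1 + x) ^ 6)⁻¹ := by ring
  have hΩ1' : ‖deriv (afeOmega q t t') u‖ ≤ C * (u + 2) * ((1 + x) ^ 6)⁻¹ := by
    refine hΩ1.trans ?_
    rw [habs]
    calc C * ((1 + Real.exp u / condQ q / ‖(1 / 2 : ℂ) + t * I‖) ^ 6)⁻¹ +
          C * ((1 + Real.exp u / condQ q / ‖(1 / 2 : ℂ) + t' * I‖) ^ 6)⁻¹ * (u + 1)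
        ≤ C * ((1 + x) ^ 6)⁻¹ + C * ((1 + x) ^ 6)⁻¹ * (u + 1) := by gcongr
      _ = C * (u + 2) * ((1 + x) ^ 6)⁻¹ := by ring
  have hkey : ((1 + x) ^ 6)⁻¹ * (1 + Real.exp u / (q * T)) ^ 4 ≤ ((1 + x) ^ 2)⁻¹ :=
    inv_pow_six_mul_le hx0 hP4
  have hlin : (5 * u + 6) * ((1 + x) ^ 2)⁻¹ ≤ (5 * L₁ + 6) * (1 + Real.exp (u - L₁))⁻¹ := by
    have h := lin_mul_inv_sq_le (u := u) hL₁0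
    rwa [hxexp] at h ⊢
  have hix0 : 0 ≤ ((1 + x) ^ 2)⁻¹ := by positivity
  constructor
  · -- ‖Ω̃‖
    rw [norm_mul, hPn]
    calc ‖afeOmega q t t' u‖ * ((1 + Real.exp u / (q * T)) ^ 4 / c₀)
        ≤ C * (1 + u) * ((1 + x) ^ 6)⁻¹ * ((1 + Real.exp u / (q * T)) ^ 4 / c₀) := by gcongr
      _ = C / c₀ * (1 + u) * (((1 + x) ^ 6)⁻¹ * (1 + Real.exp u / (q * T)) ^ 4) := by ring
      _ ≤ C / c₀ * (1 + u) * ((1 + x) ^ 2)⁻¹ := by gcongr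
      _ ≤ C / c₀ * ((5 * u + 6) * ((1 + x) ^ 2)⁻¹) := by
          rw [mul_assoc]
          have h15 : 1 + u ≤ 5 * u + 6 := by linarith
          exact mul_le_mul_of_nonneg_left (mul_le_mul_of_nonneg_right h15 hix0) (by positivity)
      _ ≤ C / c₀ * ((5 * L₁ + 6) * (1 + Real.exp (u - L₁))⁻¹) := by gcongr
      _ = C / c₀ * (5 * L₁ + 6) * (1 + Real.exp (u - L₁))⁻¹ := by ring
  · -- ‖Ω̃′‖
    rw [(hprod u).deriv]
    calc ‖deriv (afeOmega q t t') u * ((P u : ℝ) : ℂ) + afeOmega q t t' u * ((P' u : ℝ) : ℂ)‖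
        ≤ ‖deriv (afeOmega q t t') u‖ * ‖((P u : ℝ) : ℂ)‖ + ‖afeOmega q t t' u‖ * ‖((P' u : ℝ) : ℂ)‖ :=
          (norm_add_le _ _).trans (add_le_add (norm_mul_le _ _) (norm_mul_le _ _))
      _ ≤ C * (u + 2) * ((1 + x) ^ 6)⁻¹ * ((1 + Real.exp u / (q * T)) ^ 4 / c₀) +
            C * (1 + u) * ((1 + x) ^ 6)⁻¹ * (4 * ((1 + Real.exp u / (q * T)) ^ 4 / c₀)) := by
          rw [hPn]; gcongr
      _ = C / c₀ * (5 * u + 6) * (((1 + x) ^ 6)⁻¹ * (1 + Real.exp u / (q * T)) ^ 4) := by ring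
      _ ≤ C / c₀ * (5 * u + 6) * ((1 + x) ^ 2)⁻¹ := by
          have : 0 ≤ C / c₀ * (5 * u + 6) := by positivity
          gcongr
      _ = C / c₀ * ((5 * u + 6) * ((1 + x) ^ 2)⁻¹) := by ring
      _ ≤ C / c₀ * ((5 * L₁ + 6) * (1 + Real.exp (u - L₁))⁻¹) := by gcongr
      _ = C / c₀ * (5 * L₁ + 6) * (1 + Real.exp (u - L₁))⁻¹ := by ring

/-- **Pointwise majorant for the long-range weight `Ṽ = V_w·(1 + e^u/qT)⁴/c₀`** (`3/8 ≤ Re w ≤ 5/8`,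
`|Im w| ≥ 1`, `‖w‖ ≤ 2T+2`): on `u ≥ log T − 1`, `‖Ṽ(u)‖, ‖Ṽ′(u)‖ ≤ (5C/c₀)/(1 + e^{u−L₁})`,
`L₁ = log(Q(2T+2))`. [cite: ConreyIwaniec2002, §8 (8.7)–(8.9), Lemma 7.2 (7.16)] -/
theorem afeVlog_tail_pointwise :
    ∃ C : ℝ, 0 < C ∧ ∀ (q : ℕ), 0 < q → ∀ (T c₀ : ℝ), 3 ≤ T → 0 < c₀ →
      condQ q * (2 * T + 2) ≤ q * T →
      ∀ (w : ℂ), 3 / 8 ≤ w.re → w.re ≤ 5 / 8 → 1 ≤ |w.im| → ‖w‖ ≤ 2 * T + 2 →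
        Differentiable ℝ (fun u : ℝ =>
          afeVlog q w u * (((1 + Real.exp u / (q * T)) ^ 4 / c₀ : ℝ) : ℂ)) ∧
        ∀ u : ℝ, Real.log T - 1 ≤ u →
          ‖afeVlog q w u * (((1 + Real.exp u / (q * T)) ^ 4 / c₀ : ℝ) : ℂ)‖ ≤
            5 * C / c₀ * (1 + Real.exp (u - Real.log (condQ q * (2 * T + 2))))⁻¹ ∧
          ‖deriv (fun u : ℝ =>
              afeVlog q w u * (((1 + Real.exp u / (q * T)) ^ 4 / c₀ : ℝ) : ℂ)) u‖ ≤
            5 * C / c₀ * (1 + Real.exp (u - Real.log (condQ q * (2 * T + 2))))⁻¹ := by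
  obtain ⟨C, hC, hV, -⟩ := afeWeight_bounds
  refine ⟨C, hC, ?_⟩
  intro q hq T c₀ hT hc₀ hQT w hre1 hre2 him hw
  have hQ : 0 < condQ q := condQ_pos hq
  have hq0 : (0 : ℝ) < q := by exact_mod_cast hq
  have hT0 : 0 < T := by linarith
  set T₁ : ℝ := 2 * T + 2 with hT₁
  have hT₁0 : 0 < T₁ := by rw [hT₁]; linarith
  set L₁ : ℝ := Real.log (condQ q * T₁) with hL₁
  have hQT₁ : 0 < condQ q * T₁ := mul_pos hQ hT₁0
  set P : ℝ → ℝ := fun u => (1 + Real.exp u / (q * T)) ^ 4 / c₀ with hP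
  set P' : ℝ → ℝ := fun u => 4 * (1 + Real.exp u / (q * T)) ^ 3 * (Real.exp u / (q * T)) / c₀
    with hP'
  have hPd : ∀ u, HasDerivAt P (P' u) u := fun u => hasDerivAt_tailP (q * T) c₀ u
  have hVd : Differentiable ℝ (afeVlog q w) := (hV q hq w 0 hre1 hre2 him).1
  have hprod : ∀ u, HasDerivAt (fun u : ℝ => afeVlog q w u * ((P u : ℝ) : ℂ))
      (deriv (afeVlog q w) u * ((P u : ℝ) : ℂ) + afeVlog q w u * ((P' u : ℝ) : ℂ)) u :=
    fun u => (hVd u).hasDerivAt.mul (hPd u).ofReal_comp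
  refine ⟨fun u => (hprod u).differentiableAt, fun u _ => ?_⟩
  obtain ⟨-, hV0, hV1, -⟩ := hV q hq w u hre1 hre2 him
  set x : ℝ := Real.exp u / (condQ q * T₁) with hx
  have hx0 : 0 ≤ x := by positivity
  have hxexp : Real.exp (u - L₁) = x := by
    rw [hx, Real.exp_sub, hL₁, Real.exp_log hQT₁]
  have hw0 : 0 < ‖w‖ := by
    refine norm_pos_iff.mpr fun h => ?_
    rw [h] at him; simp at him; linarith
  have hy0 : 0 ≤ Real.exp u / condQ q := by positivity
  have hr : ((1 + Real.exp u / condQ q / ‖w‖) ^ 6)⁻¹ ≤ ((1 + x) ^ 6)⁻¹ := by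
    have h := inv_pow_six_anti hy0 hw0 hw
    rwa [hx, ← div_div]
  have hqT0 : 0 < (q : ℝ) * T := mul_pos hq0 hT0
  have hexqT : Real.exp u / (q * T) ≤ x := by
    rw [hx]; exact div_le_div_of_nonneg_left (Real.exp_pos u).le hQT₁ hQT
  have hP4 : (1 + Real.exp u / (q * T)) ^ 4 ≤ (1 + x) ^ 4 := by
    have : 0 ≤ Real.exp u / (q * T) := by positivity
    gcongr
  have hPn : ‖((P u : ℝ) : ℂ)‖ = (1 + Real.exp u / (q * T)) ^ 4 / c₀ := by
    rw [Complex.norm_real, Real.norm_eq_abs, hP, abs_of_nonneg (by positivity)]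
  have hP'le : ‖((P' u : ℝ) : ℂ)‖ ≤ 4 * ((1 + Real.exp u / (q * T)) ^ 4 / c₀) := by
    rw [Complex.norm_real, Real.norm_eq_abs, hP', abs_of_nonneg (by positivity)]
    have h1 : Real.exp u / (q * T) ≤ 1 + Real.exp u / (q * T) := by linarith
    have h3 : 0 ≤ (1 + Real.exp u / (q * T)) ^ 3 := by positivity
    calc 4 * (1 + Real.exp u / (q * T)) ^ 3 * (Real.exp u / (q * T)) / c₀
        ≤ 4 * (1 + Real.exp u / (q * T)) ^ 3 * (1 + Real.exp u / (q * T)) / c₀ := by gcongr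
      _ = 4 * ((1 + Real.exp u / (q * T)) ^ 4 / c₀) := by ring
  have hV0' : ‖afeVlog q w u‖ ≤ C * ((1 + x) ^ 6)⁻¹ := hV0.trans (by gcongr)
  have hV1' : ‖deriv (afeVlog q w) u‖ ≤ C * ((1 + x) ^ 6)⁻¹ := hV1.trans (by gcongr)
  have hkey : ((1 + x) ^ 6)⁻¹ * (1 + Real.exp u / (q * T)) ^ 4 ≤ ((1 + x) ^ 2)⁻¹ :=
    inv_pow_six_mul_le hx0 hP4
  have h21 : ((1 + x) ^ 2)⁻¹ ≤ (1 + Real.exp (u - L₁))⁻¹ := by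
    rw [hxexp]
    have h1 : 0 < 1 + x := by linarith
    apply inv_anti₀ h1
    nlinarith
  constructor
  · rw [norm_mul, hPn]
    calc ‖afeVlog q w u‖ * ((1 + Real.exp u / (q * T)) ^ 4 / c₀)
        ≤ C * ((1 + x) ^ 6)⁻¹ * ((1 + Real.exp u / (q * T)) ^ 4 / c₀) := by gcongr
      _ = C / c₀ * (((1 + x) ^ 6)⁻¹ * (1 + Real.exp u / (q * T)) ^ 4) := by ring
      _ ≤ C / c₀ * ((1 + x) ^ 2)⁻¹ := by gcongr
      _ ≤ 5 * C / c₀ * ((1 + x) ^ 2)⁻¹ := by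
          have : 0 ≤ ((1 + x) ^ 2)⁻¹ := by positivity
          have : C / c₀ ≤ 5 * C / c₀ := by
            rw [mul_div_assoc]; have := div_pos hC hc₀; nlinarith
          nlinarith
      _ ≤ 5 * C / c₀ * (1 + Real.exp (u - L₁))⁻¹ := by gcongr
  · rw [(hprod u).deriv]
    calc ‖deriv (afeVlog q w) u * ((P u : ℝ) : ℂ) + afeVlog q w u * ((P' u : ℝ) : ℂ)‖
        ≤ ‖deriv (afeVlog q w) u‖ * ‖((P u : ℝ) : ℂ)‖ + ‖afeVlog q w u‖ * ‖((P' u : ℝ) : ℂ)‖ :=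
          (norm_add_le _ _).trans (add_le_add (norm_mul_le _ _) (norm_mul_le _ _))
      _ ≤ C * ((1 + x) ^ 6)⁻¹ * ((1 + Real.exp u / (q * T)) ^ 4 / c₀) +
            C * ((1 + x) ^ 6)⁻¹ * (4 * ((1 + Real.exp u / (q * T)) ^ 4 / c₀)) := by
          rw [hPn]; gcongr
      _ = 5 * C / c₀ * (((1 + x) ^ 6)⁻¹ * (1 + Real.exp u / (q * T)) ^ 4) := by ring
      _ ≤ 5 * C / c₀ * ((1 + x) ^ 2)⁻¹ := by gcongr
      _ ≤ 5 * C / c₀ * (1 + Real.exp (u - L₁))⁻¹ := by gcongr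

/-- `L₁ = log(Q(2T+2))` is nonnegative (`Q ≥ 1/2π`, `2T+2 ≥ 8`) and `L₁ − (log T − 1) ≤ log q + 1`
when `Q(2T+2) ≤ qT`. [cite: ConreyIwaniec2002, §8 (8.7)] -/
theorem logQT_facts {q : ℕ} (hq : 0 < q) {T : ℝ} (hT : 3 ≤ T)
    (hQT : condQ q * (2 * T + 2) ≤ q * T) :
    0 ≤ Real.log (condQ q * (2 * T + 2)) ∧
      max (Real.log (condQ q * (2 * T + 2)) - (Real.log T - 1)) 0 ≤ Real.log q + 1 ∧
      Real.log (condQ q * (2 * T + 2)) ≤ Real.log q + Real.log T := by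
  have hQ : 0 < condQ q := condQ_pos hq
  have hq0 : (0 : ℝ) < q := by exact_mod_cast hq
  have hq1 : (1 : ℝ) ≤ q := by exact_mod_cast hq
  have hT0 : 0 < T := by linarith
  have hQT₁ : 0 < condQ q * (2 * T + 2) := by positivity
  have hQ1 : 1 / (2 * Real.pi) ≤ condQ q := by
    unfold condQ
    gcongr
    exact le_trans (by norm_num) (Real.one_le_sqrt.mpr hq1)
  have h1 : (1 : ℝ) ≤ condQ q * (2 * T + 2) := by
    have hpi : Real.pi ≤ 4 := Real.pi_le_four
    calc (1 : ℝ) = 1 / (2 * 4) * 8 := by norm_num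
      _ ≤ 1 / (2 * Real.pi) * (2 * T + 2) := by gcongr; linarith
      _ ≤ condQ q * (2 * T + 2) := by gcongr
  have hlogq : 0 ≤ Real.log q := Real.log_nonneg hq1
  have h3 : Real.log (condQ q * (2 * T + 2)) ≤ Real.log q + Real.log T := by
    rw [← Real.log_mul hq0.ne' hT0.ne']
    exact Real.log_le_log hQT₁ hQT
  refine ⟨Real.log_nonneg h1, ?_, h3⟩
  refine max_le (by linarith) (by linarith)

/-- **The long-range weight `ω_t = Θ₃·Ω_{t,t′}·(1 + e^u/qT)⁴/c₀` is admissible with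
`‖ω‖₂² + ‖ω′‖₂² ≤ K c₀^{−2}(L₁ + 2)²(log q + 2)` and `‖ω‖_∞ ≤ K c₀^{−1}(L₁ + 2)`**
(`Θ₃` the half-window of `exists_smoothHalfWindow` at `log T`, `L₁ = log(Q(2T+2)) ≤ log qT`):
CI §8 (8.5)–(8.7), the range `n > T` with `c ≪ (log T)² log q`.
[cite: ConreyIwaniec2002, §8 (8.5)–(8.7)] -/
theorem omega_tail_admissible :
    ∃ K : ℝ, 0 < K ∧ ∀ (q : ℕ), 0 < q → ∀ (T c₀ : ℝ), 3 ≤ T → 0 < c₀ →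
      condQ q * (2 * T + 2) ≤ q * T →
      ∃ Θ : ℝ → ℝ, (∀ u, Real.log T ≤ u → Θ u = 1) ∧ (∀ u, u ≤ Real.log T - 1 → Θ u = 0) ∧
        (∀ u, 0 ≤ Θ u ∧ Θ u ≤ 1) ∧
        ∀ (t t' : ℝ), 2 ≤ |t| → t' ≠ t → |t' - t| ≤ 1 →
          ‖(1 / 2 : ℂ) + t * I‖ ≤ 2 * T + 2 → ‖(1 / 2 : ℂ) + t' * I‖ ≤ 2 * T + 2 →
          Differentiable ℝ (fun u : ℝ => (Θ u : ℂ) *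
            (afeOmega q t t' u * (((1 + Real.exp u / (q * T)) ^ 4 / c₀ : ℝ) : ℂ))) ∧
          MeasureTheory.Integrable (fun u : ℝ => (Θ u : ℂ) *
            (afeOmega q t t' u * (((1 + Real.exp u / (q * T)) ^ 4 / c₀ : ℝ) : ℂ))) ∧
          MeasureTheory.Integrable (deriv (fun u : ℝ => (Θ u : ℂ) *
            (afeOmega q t t' u * (((1 + Real.exp u / (q * T)) ^ 4 / c₀ : ℝ) : ℂ)))) ∧
          MeasureTheory.MemLp (fun u : ℝ => (Θ u : ℂ) *
            (afeOmega q t t' u * (((1 + Real.exp u / (q * T)) ^ 4 / c₀ : ℝ) : ℂ))) 2 ∧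
          MeasureTheory.MemLp (deriv (fun u : ℝ => (Θ u : ℂ) *
            (afeOmega q t t' u * (((1 + Real.exp u / (q * T)) ^ 4 / c₀ : ℝ) : ℂ)))) 2 ∧
          (∫ u : ℝ, ‖(Θ u : ℂ) *
              (afeOmega q t t' u * (((1 + Real.exp u / (q * T)) ^ 4 / c₀ : ℝ) : ℂ))‖ ^ 2) +
            (∫ u : ℝ, ‖deriv (fun u : ℝ => (Θ u : ℂ) *
              (afeOmega q t t' u * (((1 + Real.exp u / (q * T)) ^ 4 / c₀ : ℝ) : ℂ))) u‖ ^ 2) ≤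
            K / c₀ ^ 2 * (Real.log (condQ q * (2 * T + 2)) + 2) ^ 2 * (Real.log q + 2) ∧
          (∀ u : ℝ, ‖(Θ u : ℂ) *
              (afeOmega q t t' u * (((1 + Real.exp u / (q * T)) ^ 4 / c₀ : ℝ) : ℂ))‖ ≤
            K / c₀ * (Real.log (condQ q * (2 * T + 2)) + 2)) := by
  obtain ⟨C, hC, hpt⟩ := omega_tail_pointwise
  obtain ⟨C₀, hC₀, hwin⟩ := WeightedMeanValue.exists_smoothHalfWindow
  refine ⟨(1 + (C₀ + 1) ^ 2) * 36 * C ^ 2 + 6 * C, by positivity, ?_⟩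
  intro q hq T c₀ hT hc₀ hQT
  obtain ⟨Θ, hΘd, hΘ1, hΘ0, hΘ01, hΘ', hΘ'0⟩ := hwin (Real.log T)
  refine ⟨Θ, hΘ1, hΘ0, hΘ01, fun t t' ht htt' hdist hs hs' => ?_⟩
  obtain ⟨hL0, hmax, -⟩ := logQT_facts hq hT hQT
  set L₁ : ℝ := Real.log (condQ q * (2 * T + 2)) with hL₁
  set M : ℝ := C / c₀ * (5 * L₁ + 6) with hM
  have hM0 : 0 ≤ M := by positivity
  obtain ⟨hdiff, hbd⟩ := hpt q hq T c₀ hT hc₀ hQT t t' ht htt' hdist hs hs'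
  obtain ⟨hΦ1, hΦ2, hΦint⟩ := logistic_majorant_integral (Real.log T - 1) L₁ M
  obtain ⟨h1, h2, h3, h4, h5, h6⟩ := WeightedMeanValue.halfWindow_weight_admissible hΘd hΘ0 hΘ01
    hΘ' hΘ'0 hdiff hΦ1 hΦ2 (fun u hu => (hbd u hu).1) (fun u hu => (hbd u hu).2)
  have hM6 : 5 * L₁ + 6 ≤ 6 * (L₁ + 2) := by linarith
  refine ⟨h1, h2, h3, h4, h5, h6.trans ?_, fun u => ?_⟩
  · have hlq : 0 ≤ Real.log q + 2 := by
      have : (1 : ℝ) ≤ q := by exact_mod_cast hq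
      linarith [Real.log_nonneg this]
    have hm2 : 1 + max (L₁ - (Real.log T - 1)) 0 ≤ Real.log q + 2 := by linarith [hmax]
    have hMle : M ≤ C / c₀ * (6 * (L₁ + 2)) := by rw [hM]; gcongr
    have hM2 : M ^ 2 ≤ (C / c₀ * (6 * (L₁ + 2))) ^ 2 := pow_le_pow_left₀ hM0 hMle 2
    calc (1 + (C₀ + 1) ^ 2) * ∫ u in Set.Ici (Real.log T - 1), (M * (1 + Real.exp (u - L₁))⁻¹) ^ 2
        ≤ (1 + (C₀ + 1) ^ 2) * (M ^ 2 * (1 + max (L₁ - (Real.log T - 1)) 0)) := by gcongr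
      _ ≤ (1 + (C₀ + 1) ^ 2) * ((C / c₀ * (6 * (L₁ + 2))) ^ 2 * (Real.log q + 2)) := by
          apply mul_le_mul_of_nonneg_left _ (by positivity)
          exact mul_le_mul hM2 hm2 (by positivity) (by positivity)
      _ = ((1 + (C₀ + 1) ^ 2) * 36 * C ^ 2) / c₀ ^ 2 * (L₁ + 2) ^ 2 * (Real.log q + 2) := by
          field_simp
          ring
      _ ≤ ((1 + (C₀ + 1) ^ 2) * 36 * C ^ 2 + 6 * C) / c₀ ^ 2 * (L₁ + 2) ^ 2 * (Real.log q + 2) := by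
          gcongr
          linarith
  · rw [norm_mul, Complex.norm_real, Real.norm_eq_abs, abs_of_nonneg (hΘ01 u).1]
    rcases le_or_gt u (Real.log T - 1) with hu | hu
    · rw [hΘ0 u hu, zero_mul]; positivity
    · have hb := (hbd u hu.le).1
      have hle1 : (1 + Real.exp (u - L₁))⁻¹ ≤ 1 :=
        inv_le_one_of_one_le₀ (by linarith [Real.exp_pos (u - L₁)])
      calc Θ u * ‖afeOmega q t t' u * (((1 + Real.exp u / (q * T)) ^ 4 / c₀ : ℝ) : ℂ)‖
          ≤ 1 * (C / c₀ * (5 * L₁ + 6) * (1 + Real.exp (u - L₁))⁻¹) := by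
            gcongr; exact (hΘ01 u).2
        _ ≤ 1 * (C / c₀ * (6 * (L₁ + 2)) * 1) := by gcongr
        _ = 6 * C / c₀ * (L₁ + 2) := by ring
        _ ≤ ((1 + (C₀ + 1) ^ 2) * 36 * C ^ 2 + 6 * C) / c₀ * (L₁ + 2) := by
            gcongr
            nlinarith [sq_nonneg C, sq_nonneg (C₀ + 1)]

/-- **The long-range weight `ω_s = Θ₃·V_s·(1 + e^u/qT)⁴/c₀` is admissible with
`‖ω‖₂² + ‖ω′‖₂² ≤ K c₀^{−2}(log q + 2)` and `‖ω‖_∞ ≤ K c₀^{−1}`** (`3/8 ≤ Re s ≤ 5/8`,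
`|Im s| ≥ 1`, `‖s‖ ≤ 2T+2`): CI §8 (8.7)–(8.9), the range `n > T` of `A(s) − N(s)`.
[cite: ConreyIwaniec2002, §8 (8.7)–(8.9)] -/
theorem afeVlog_tail_admissible :
    ∃ K : ℝ, 0 < K ∧ ∀ (q : ℕ), 0 < q → ∀ (T c₀ : ℝ), 3 ≤ T → 0 < c₀ →
      condQ q * (2 * T + 2) ≤ q * T →
      ∃ Θ : ℝ → ℝ, (∀ u, Real.log T ≤ u → Θ u = 1) ∧ (∀ u, u ≤ Real.log T - 1 → Θ u = 0) ∧
        (∀ u, 0 ≤ Θ u ∧ Θ u ≤ 1) ∧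
        ∀ (w : ℂ), 3 / 8 ≤ w.re → w.re ≤ 5 / 8 → 1 ≤ |w.im| → ‖w‖ ≤ 2 * T + 2 →
          Differentiable ℝ (fun u : ℝ => (Θ u : ℂ) *
            (afeVlog q w u * (((1 + Real.exp u / (q * T)) ^ 4 / c₀ : ℝ) : ℂ))) ∧
          MeasureTheory.Integrable (fun u : ℝ => (Θ u : ℂ) *
            (afeVlog q w u * (((1 + Real.exp u / (q * T)) ^ 4 / c₀ : ℝ) : ℂ))) ∧
          MeasureTheory.Integrable (deriv (fun u : ℝ => (Θ u : ℂ) *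
            (afeVlog q w u * (((1 + Real.exp u / (q * T)) ^ 4 / c₀ : ℝ) : ℂ)))) ∧
          MeasureTheory.MemLp (fun u : ℝ => (Θ u : ℂ) *
            (afeVlog q w u * (((1 + Real.exp u / (q * T)) ^ 4 / c₀ : ℝ) : ℂ))) 2 ∧
          MeasureTheory.MemLp (deriv (fun u : ℝ => (Θ u : ℂ) *
            (afeVlog q w u * (((1 + Real.exp u / (q * T)) ^ 4 / c₀ : ℝ) : ℂ)))) 2 ∧
          (∫ u : ℝ, ‖(Θ u : ℂ) *
              (afeVlog q w u * (((1 + Real.exp u / (q * T)) ^ 4 / c₀ : ℝ) : ℂ))‖ ^ 2) +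
            (∫ u : ℝ, ‖deriv (fun u : ℝ => (Θ u : ℂ) *
              (afeVlog q w u * (((1 + Real.exp u / (q * T)) ^ 4 / c₀ : ℝ) : ℂ))) u‖ ^ 2) ≤
            K / c₀ ^ 2 * (Real.log q + 2) ∧
          (∀ u : ℝ, ‖(Θ u : ℂ) *
              (afeVlog q w u * (((1 + Real.exp u / (q * T)) ^ 4 / c₀ : ℝ) : ℂ))‖ ≤ K / c₀) := by
  obtain ⟨C, hC, hpt⟩ := afeVlog_tail_pointwise
  obtain ⟨C₀, hC₀, hwin⟩ := WeightedMeanValue.exists_smoothHalfWindow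
  refine ⟨(1 + (C₀ + 1) ^ 2) * 25 * C ^ 2 + 5 * C, by positivity, ?_⟩
  intro q hq T c₀ hT hc₀ hQT
  obtain ⟨Θ, hΘd, hΘ1, hΘ0, hΘ01, hΘ', hΘ'0⟩ := hwin (Real.log T)
  refine ⟨Θ, hΘ1, hΘ0, hΘ01, fun w hre1 hre2 him hw => ?_⟩
  obtain ⟨hL0, hmax, -⟩ := logQT_facts hq hT hQT
  set L₁ : ℝ := Real.log (condQ q * (2 * T + 2)) with hL₁
  set M : ℝ := 5 * C / c₀ with hM
  have hM0 : 0 ≤ M := by positivity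
  obtain ⟨hdiff, hbd⟩ := hpt q hq T c₀ hT hc₀ hQT w hre1 hre2 him hw
  obtain ⟨hΦ1, hΦ2, hΦint⟩ := logistic_majorant_integral (Real.log T - 1) L₁ M
  obtain ⟨h1, h2, h3, h4, h5, h6⟩ := WeightedMeanValue.halfWindow_weight_admissible hΘd hΘ0 hΘ01
    hΘ' hΘ'0 hdiff hΦ1 hΦ2 (fun u hu => (hbd u hu).1) (fun u hu => (hbd u hu).2)
  have hlq : 0 ≤ Real.log q + 2 := by
    have : (1 : ℝ) ≤ q := by exact_mod_cast hq
    linarith [Real.log_nonneg this]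
  refine ⟨h1, h2, h3, h4, h5, h6.trans ?_, fun u => ?_⟩
  · have hm2 : 1 + max (L₁ - (Real.log T - 1)) 0 ≤ Real.log q + 2 := by linarith [hmax]
    calc (1 + (C₀ + 1) ^ 2) * ∫ u in Set.Ici (Real.log T - 1), (M * (1 + Real.exp (u - L₁))⁻¹) ^ 2
        ≤ (1 + (C₀ + 1) ^ 2) * (M ^ 2 * (1 + max (L₁ - (Real.log T - 1)) 0)) := by gcongr
      _ ≤ (1 + (C₀ + 1) ^ 2) * (M ^ 2 * (Real.log q + 2)) :=
          mul_le_mul_of_nonneg_left (mul_le_mul_of_nonneg_left hm2 (sq_nonneg M)) (by positivity)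
      _ = ((1 + (C₀ + 1) ^ 2) * 25 * C ^ 2) / c₀ ^ 2 * (Real.log q + 2) := by
          rw [hM]; field_simp; ring
      _ ≤ ((1 + (C₀ + 1) ^ 2) * 25 * C ^ 2 + 5 * C) / c₀ ^ 2 * (Real.log q + 2) := by
          gcongr; linarith
  · rw [norm_mul, Complex.norm_real, Real.norm_eq_abs, abs_of_nonneg (hΘ01 u).1]
    rcases le_or_gt u (Real.log T - 1) with hu | hu
    · rw [hΘ0 u hu, zero_mul]; positivity
    · have hb := (hbd u hu.le).1
      have hle1 : (1 + Real.exp (u - L₁))⁻¹ ≤ 1 :=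
        inv_le_one_of_one_le₀ (by linarith [Real.exp_pos (u - L₁)])
      calc Θ u * ‖afeVlog q w u * (((1 + Real.exp u / (q * T)) ^ 4 / c₀ : ℝ) : ℂ)‖
          ≤ 1 * (5 * C / c₀ * (1 + Real.exp (u - L₁))⁻¹) := by
            gcongr; exact (hΘ01 u).2
        _ ≤ 1 * (5 * C / c₀ * 1) := by gcongr
        _ = 5 * C / c₀ := by ring
        _ ≤ ((1 + (C₀ + 1) ^ 2) * 25 * C ^ 2 + 5 * C) / c₀ := by
            gcongr
            nlinarith [sq_nonneg C, sq_nonneg (C₀ + 1)]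

end ConreyIwaniec2002

end Literature.NumberTheory.LFunctions
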